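import Summits.HodgeConjecture.HodgeConjecture.Theorems.Ring2BindersAbelianSchemeVHCShadow
import Literature.AlgebraicGeometry.HodgeTheory.AlgebraicClassesPullbackDimLEThree
import Literature.AlgebraicGeometry.HodgeTheory.LefschetzDecompositionSingular
import Literature.AlgebraicGeometry.HodgeTheory.LefschetzOneOneHolds
import Literature.AlgebraicGeometry.HodgeTheory.HodgeTypeConjugation
import HarnessLib

/-!
# Ring 2 — binder seat b02 (Hodge ladder stage 3): the FIRST LEFSCHETZ STEP of a global class, done GLOBALLY along an
# abelian-fibred quasi-projective carrier, and the per-carrier reduction of row b02 `AbelianSchemeVHC` to its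
# fibrewise LEFSCHETZ-PRIMITIVE instances (fact-free)

HONEST FRAMING: research route conditional on HC_CM; not a corollary; Q11.4-sentence-2 already refuted in dim ≥ 3.

Cell `pub-hodge-ring2`, binder seat `ring2-b02`, row b02 of `BINDER-OWNERS.md` (`Ring2.Hypotheses.AbelianSchemeVHC`,
`Theorems/Ring2Hypotheses.lean`; OPEN, print-equivalent to `HC_AV`, nothing to discharge). `HC_CM`
(`Theses.RankFourFaces.CMAbelianHodge`) does not occur below; nothing here is a case of the Hodge conjecture; no `sorry`, no
definition, no NEW Literature fact, no node; «10 · 0» untouched.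

WHAT THIS PART DOES. AbelianAll part XIV (`Theorems.mem_algebraicClasses_of_forall_mem_primitiveClasses`, fact-free) reduces the
Hodge conjecture for ONE smooth projective `n`-fold `X` with a hard Lefschetz datum `[H]` to its LEFSCHETZ-PRIMITIVE rational `(p,p)`
classes `c ∈ P^{2p} = ker (L^{n-2p+1} : H^{2p} → H^{2n-2p+2})` with `2 ≤ p`, `2p ≤ n`, through the first Lefschetz step
`c = c₀ + [H] ∪ c'` (`c₀` primitive, `c'` of codimension `p - 1`) and induction on `p`. This file is the VARIATIONAL form of that
step for row b02: along a smooth projective family `f : 𝒳 ⟶ S` of relative dimension `n` with quasi-projective total space over a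
smooth irreducible quasi-projective base, all complex fibres abelian varieties, and for the shadow part's ONE global class
`K ∈ H²(𝒳(ℂ); ℂ)` polarising every fibre (`exists_forall_isPolarizationClass_map_fiberι`), the decomposition of a GLOBAL class
`W ∈ H^{2(l+1)}(𝒳(ℂ); ℂ)`, fibrewise rational of type `(l+1, l+1)`, is itself GLOBAL:

* §1 **`exists_primitive_add_lefschetzPowTo`** — `W = W₀ + L_K W'` with `W' ∈ H^{2l}(𝒳(ℂ); ℂ)` fibrewise rational `(l,l)` and
  `W₀` fibrewise rational `(l+1,l+1)` and fibrewise `K|_{𝒳_s}`-PRIMITIVE; at every fibre where `W|` is algebraic so are `W'|`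
  and `W₀|`. Construction: `n = 2(l+1) + i`; `W'|_{𝒳_s}` is THE preimage of `(L_K^{i+1} W)|_{𝒳_s}` under the hard-Lefschetz
  isomorphism `L^{i+2}_{K|} : H^{2l}(𝒳_s) → H^{2n-2l}(𝒳_s)` (Voisin I Thm. 6.25, rationality §7.1.2, Hodge type Rem. 6.27 — the
  fields of the tree's `HardLefschetzNFold` datum of the polarisation class `K|_{𝒳_s}`); these preimages form a CONTINUOUS section
  of the espace étalé of `R^{2l} f_* ℂ` (shadow part §2 `continuous_mk_hardLefschetzPreimage`), hence are the restrictions of ONE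
  class `W'` of the total space — Deligne 1968 / Voisin II Thm. 4.18 "invariant classes come from the total space", a THEOREM of
  the tree on quasi-projective carriers (`exists_forall_eq_globalSection_of_isQuasiProjectiveOver`, with the identity principle
  Lemma 4.17); `W₀ := W - L_K W'` is killed fibrewise by `L^{i+1}`, i.e. lies in `P^{2(l+1)}(𝒳_s, K|)` (Voisin I Def. 6.24,
  `primitiveClasses_eq_ker`); algebraicity of `W|_{𝒳_s}` descends to `W'|_{𝒳_s}` by `A(𝒳_s, K|_{𝒳_s})` — Lieberman's theorem
  for the abelian variety `𝒳_s` (shadow part §3 `standardConjectureA_of_iso_abelianVariety`, `mem_algebraicClasses_of_lefschetzPowTo_mem`).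
* §2 **`map_fiberι_mem_algebraicClasses_of_forall_mem_primitiveClasses`** — ON SUCH A CARRIER, THE CONCLUSION OF ROW b02 IN
  EVERY CODIMENSION FOLLOWS FROM ITS INSTANCES ON FIBREWISE `K`-PRIMITIVE CLASSES OF CODIMENSION `2 ≤ p ≤ n/2` (any target set
  of fibres `T`, any anchor `s₀`): strong induction on `p` inside the lower half exactly as part XIV — `p = 0`
  (`algebraicClasses_zero`), `p = 1` (Lefschetz `(1,1)` on the fibre, the tree's theorem `lefschetzOneOne_rational_holds`),
  `p = l + 2` by §1 (`W₀|` by the primitive instance, `W'|` by induction, `(L_K W')| = K| ∪ W'|` algebraic by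
  `HardLefschetzNFold.L_mem_algebraicClasses_of_mem`) — and the shadow part's `map_fiberι_mem_algebraicClasses_of_lowerHalf`
  above the middle. FACT-FREE (closures are the three standard axioms).

The binder-level statements (row b02 ⟺ its fibrewise-primitive deep-middle form modulo the print residual c20 / N97, and
the even-relative-dimension refinement through the middle lift) are the sequel `Ring2BindersAbelianSchemeVHCPrimitive.lean`.
What is NOT claimed: any case of `AbelianSchemeVHC` or of HC; anything about `HC_CM`; anything on carriers whose total space is
not quasi-projective (there the global polarising class is the print residual N96/N97 itself).

References: [VoisinHodgeI2002] §6.2.3 Def. 6.24, Thm. 6.25, Cor. 6.26, Rem. 6.27, §7.1.2, Thm. 11.30; [VoisinHodgeII2003]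
Lemma 4.17, Thm. 4.18, §9.2.4 Prop. 9.20; [Deligne1968] Prop. (2.1), (2.6.3); [KerrPearlstein2011] §3.1; [Lieberman1968] main
theorem; [Kleiman1968AlgebraicCycles] §2, Thm. 2A11; [CharlesSchnell2014Notes] Conj. 11.3.1, Prop. 11.3.5;
[BrosnanFangNiePearlstein2009] §6 Lemma 48.
-/

-- every declaration of this problem lives in `Summit.HodgeConjecture.HodgeConjecture.…` (summit = sub-problem);
-- namespace `…Ring2.Binders` = the binder seats of the cell's Hodge-ladder stage 3 (`BINDER-OWNERS.md`)
set_option linter.dupNamespace false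

noncomputable section

open CategoryTheory AlgebraicGeometry Topology Filter
open Literature.AlgebraicGeometry Literature.AlgebraicGeometry.Motives
open Literature.AlgebraicGeometry.HodgeTheory

namespace Summit.HodgeConjecture.HodgeConjecture.Ring2.Binders

variable {𝒳 S : SchemeOver ℂ}

/-! ## §1 The first Lefschetz step of a global class is global (quasi-projective abelian-fibred carriers; fact-free) -/

/-- **The first Lefschetz step of a global class, globally.** Let `f : 𝒳 ⟶ S` be a smooth projective family of relative
dimension `n` with quasi-projective total space over a smooth irreducible quasi-projective base, all complex fibres abelian
varieties, `K ∈ H²(𝒳(ℂ); ℂ)` a global class polarising every fibre, and `W ∈ H^{2(l+1)}(𝒳(ℂ); ℂ)`, `2(l+1) ≤ n`, fibrewise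
rational of type `(l+1, l+1)`. Then `W = W₀ + L_K W'` with `W' ∈ H^{2l}(𝒳(ℂ); ℂ)` fibrewise rational of type `(l, l)`, `W₀`
fibrewise rational of type `(l+1, l+1)` and fibrewise `K|_{𝒳_s}`-PRIMITIVE (`W₀|_{𝒳_s} ∈ P^{2(l+1)} = ker L^{n-2l-1}`), and at
every fibre where `W|` is algebraic, `W₀|` and `W'|` are algebraic. (`W'|_{𝒳_s}` = the hard-Lefschetz preimage of
`(L_K^{n-2l-1} W)|_{𝒳_s}` under `L^{n-2l}`; one global `W'` by continuity of these preimages and Deligne 1968 on quasi-projective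
carriers; descent of algebraicity by `A(𝒳_s, K|)`, Lieberman.) FACT-FREE. [cite: VoisinHodgeI2002, §6.2.3 Def. 6.24, Thm. 6.25,
Cor. 6.26, Rem. 6.27 and §7.1.2] [cite: VoisinHodgeII2003, Lemma 4.17 and Thm. 4.18] [cite: Deligne1968, Prop. (2.1)]
[cite: Lieberman1968, main theorem] [cite: KerrPearlstein2011, §3.1] -/
theorem exists_primitive_add_lefschetzPowTo (f : 𝒳 ⟶ S) {n : ℕ} (hf : IsSmoothProjectiveFamily f n)
    (h𝒳 : IsQuasiProjectiveOver 𝒳) (hS : IsQuasiProjectiveOver S) [IrreducibleSpace S.left]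
    (hSs : AlgebraicGeometry.Smooth S.hom)
    (hA : ∀ s : ComplexPoints S, ∃ A' : AbelianVariety ℂ, A'.dim = n ∧ Nonempty (A'.X ≅ fiberOver f s))
    (K : complexBetti 𝒳 2)
    (hK : ∀ s : ComplexPoints S, IsPolarizationClass n (fiberOver f s) (complexBetti.map (fiberι f s) 2 K))
    {l : ℕ} (hln : 2 * (l + 1) ≤ n) (W : complexBetti 𝒳 (2 * (l + 1)))
    (hW : ∀ s : ComplexPoints S, IsRationalClass (complexBetti.map (fiberι f s) (2 * (l + 1)) W) ∧
      IsOfHodgeType n (fiberOver f s) (2 * (l + 1)) (l + 1) (l + 1) (complexBetti.map (fiberι f s) (2 * (l + 1)) W)) :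
    ∃ (W₀ : complexBetti 𝒳 (2 * (l + 1))) (W' : complexBetti 𝒳 (2 * l)),
      W = W₀ + lefschetzPowTo K 1 (2 * l) (2 * (l + 1)) (by omega) W' ∧
      (∀ s : ComplexPoints S, IsRationalClass (complexBetti.map (fiberι f s) (2 * (l + 1)) W₀) ∧
        IsOfHodgeType n (fiberOver f s) (2 * (l + 1)) (l + 1) (l + 1) (complexBetti.map (fiberι f s) (2 * (l + 1)) W₀)) ∧
      (∀ s : ComplexPoints S, complexBetti.map (fiberι f s) (2 * (l + 1)) W₀ ∈
        primitiveClasses (complexBetti.map (fiberι f s) 2 K) n (2 * (l + 1))) ∧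
      (∀ s : ComplexPoints S, IsRationalClass (complexBetti.map (fiberι f s) (2 * l) W') ∧
        IsOfHodgeType n (fiberOver f s) (2 * l) l l (complexBetti.map (fiberι f s) (2 * l) W')) ∧
      ∀ s : ComplexPoints S,
        complexBetti.map (fiberι f s) (2 * (l + 1)) W ∈ algebraicClasses (fiberOver f s) (l + 1) →
        complexBetti.map (fiberι f s) (2 * (l + 1)) W₀ ∈ algebraicClasses (fiberOver f s) (l + 1) ∧
          complexBetti.map (fiberι f s) (2 * l) W' ∈ algebraicClasses (fiberOver f s) l := by
  haveI := hSs
  haveI : IsSeparated S.hom := hS.isSeparated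
  haveI : LocallyOfFiniteType S.hom := inferInstance
  haveI : ConnectedSpace (ComplexPoints S) := (ComplexPoints.connectedSpace_iff_holds S).2 inferInstance
  -- `n = 2(l+1) + i`; the primitivity exponent in degree `2(l+1)` is `i + 1`, the hard-Lefschetz exponent of `H^{2l}` is `i + 2`
  obtain ⟨i, hi⟩ : ∃ i, n = 2 * (l + 1) + i := ⟨n - 2 * (l + 1), by omega⟩
  have hm : 2 * (l + 1) + 2 * (i + 1) = 2 * (l + 1 + (i + 1)) := by omega
  have hjk : 2 * l + (1 + (i + 1)) = n := by omega
  have hm₂ : 2 * l + 2 * (1 + (i + 1)) = 2 * (l + 1 + (i + 1)) := by omega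
  have hm₁ : 2 * l + 2 * 1 = 2 * (l + 1) := by omega
  have hidx : l + 1 + (i + 1) = l + (1 + (i + 1)) := by omega
  -- the hard Lefschetz data of the polarisation classes `K|_{𝒳_s}`
  choose Λ hΛ using fun s ↦ (hK s).exists_hardLefschetzNFold (hf.isSmoothProjective s)
  -- `D := L_K^{i+1} W`, a global class, fibrewise rational of type `(l+i+2, l+i+2)`
  set D : complexBetti 𝒳 (2 * (l + 1 + (i + 1))) :=
    lefschetzPowTo K (i + 1) (2 * (l + 1)) (2 * (l + 1 + (i + 1))) hm W with hD
  have hDs : ∀ s, complexBetti.map (fiberι f s) (2 * (l + 1 + (i + 1))) D =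
      lefschetzPowTo (complexBetti.map (fiberι f s) 2 K) (i + 1) (2 * (l + 1)) (2 * (l + 1 + (i + 1))) hm
        (complexBetti.map (fiberι f s) (2 * (l + 1)) W) := fun s ↦ by
    rw [hD, map_lefschetzPowTo]
  -- the fibrewise rational `(l,l)` preimages of `D|_{𝒳_s}` under `L^{i+2}` (hard Lefschetz, `2l + (i+2) = n`)
  have hex : ∀ s : ComplexPoints S, ∃ c' : complexBetti (fiberOver f s) (2 * l),
      IsRationalClass c' ∧ IsOfHodgeType n (fiberOver f s) (2 * l) l l c' ∧
        (Λ s).L (1 + (i + 1)) (2 * l) (2 * (l + 1 + (i + 1))) hm₂ c' =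
          complexBetti.map (fiberι f s) (2 * (l + 1 + (i + 1))) D := by
    intro s
    have hd_rat : IsRationalClass (complexBetti.map (fiberι f s) (2 * (l + 1 + (i + 1))) D) := by
      rw [hDs, ← hΛ s]
      exact (Λ s).isRationalClass_L _ _ _ hm (hW s).1
    have hd_typ : IsOfHodgeType n (fiberOver f s) (2 * (l + 1 + (i + 1))) (l + (1 + (i + 1))) (l + (1 + (i + 1)))
        (complexBetti.map (fiberι f s) (2 * (l + 1 + (i + 1))) D) := by
      rw [hDs, ← hΛ s, ← hidx]
      exact (Λ s).isOfHodgeType_L (i + 1) (2 * (l + 1)) (2 * (l + 1 + (i + 1))) hm (l + 1) (l + 1) (hW s).2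
    exact (Λ s).exists_hdg_preimage hjk _ hm₂ l l _ hd_rat hd_typ
  choose c hc₁ hc₂ hc₃ using hex
  have hc₃' : ∀ s, lefschetzPowTo (complexBetti.map (fiberι f s) 2 K) (1 + (i + 1)) (2 * l) (2 * (l + 1 + (i + 1))) hm₂
      (c s) = complexBetti.map (fiberι f s) (2 * (l + 1 + (i + 1))) D := fun s ↦ by
    rw [← hΛ s]; exact hc₃ s
  have hbij : ∀ s, Function.Bijective
      (lefschetzPowTo (complexBetti.map (fiberι f s) 2 K) (1 + (i + 1)) (2 * l) (2 * (l + 1 + (i + 1))) hm₂) :=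
    fun s ↦ by rw [← hΛ s]; exact (Λ s).bijective_L hjk _ hm₂
  -- continuity (shadow part §2) and ONE global class `W'` (Deligne 1968 on quasi-projective carriers, a tree theorem)
  have hσ : Continuous fun s ↦ (⟨s, c s⟩ : FiberClass f (2 * l)) :=
    continuous_mk_hardLefschetzPreimage f
      (isCohomologicallyLocallyTrivialOn_univ_of_isSmoothProjectiveFamily_of_smooth f hf) K hm₂ D hbij c hc₃'
  rcases isEmpty_or_nonempty (ComplexPoints S) with hS0 | ⟨⟨s₀⟩⟩
  · exact ⟨W, 0, by rw [map_zero, add_zero], fun s ↦ (hS0.false s).elim, fun s ↦ (hS0.false s).elim,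
      fun s ↦ (hS0.false s).elim, fun s ↦ (hS0.false s).elim⟩
  obtain ⟨W', hW'⟩ := exists_forall_eq_globalSection_of_isQuasiProjectiveOver f hf h𝒳 hS hσ (fun _ ↦ rfl) s₀
  have hcW' : ∀ s, c s = complexBetti.map (fiberι f s) (2 * l) W' := fun s ↦ (FiberClass.mk_eq_mk_iff _ _).1 (hW' s)
  -- fibrewise: `(L_K W')| = L_{K|} (W'|)`, rational of type `(l+1, l+1)`, and `L^{i+1} ((L_K W')|) = D|`
  have hLW' : ∀ s, complexBetti.map (fiberι f s) (2 * (l + 1)) (lefschetzPowTo K 1 (2 * l) (2 * (l + 1)) hm₁ W') =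
      lefschetzPowTo (complexBetti.map (fiberι f s) 2 K) 1 (2 * l) (2 * (l + 1)) hm₁
        (complexBetti.map (fiberι f s) (2 * l) W') := fun s ↦ by
    rw [map_lefschetzPowTo]
  have hLW'_rat : ∀ s, IsRationalClass
      (complexBetti.map (fiberι f s) (2 * (l + 1)) (lefschetzPowTo K 1 (2 * l) (2 * (l + 1)) hm₁ W')) := fun s ↦ by
    rw [hLW', ← hΛ s]
    exact (Λ s).isRationalClass_L 1 _ _ hm₁ (hcW' s ▸ hc₁ s)
  have hLW'_typ : ∀ s, IsOfHodgeType n (fiberOver f s) (2 * (l + 1)) (l + 1) (l + 1)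
      (complexBetti.map (fiberι f s) (2 * (l + 1)) (lefschetzPowTo K 1 (2 * l) (2 * (l + 1)) hm₁ W')) := fun s ↦ by
    rw [hLW', ← hΛ s]
    exact (Λ s).isOfHodgeType_L 1 (2 * l) (2 * (l + 1)) hm₁ l l (hcW' s ▸ hc₂ s)
  have hLLW' : ∀ s, lefschetzPowTo (complexBetti.map (fiberι f s) 2 K) (i + 1) (2 * (l + 1)) (2 * (l + 1 + (i + 1))) hm
      (complexBetti.map (fiberι f s) (2 * (l + 1)) (lefschetzPowTo K 1 (2 * l) (2 * (l + 1)) hm₁ W')) =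
      complexBetti.map (fiberι f s) (2 * (l + 1 + (i + 1))) D := fun s ↦ by
    rw [hLW', lefschetzPowTo_lefschetzPowTo _ (i + 1) hm₁ hm hm₂, ← hcW' s, hc₃' s]
  refine ⟨W - lefschetzPowTo K 1 (2 * l) (2 * (l + 1)) hm₁ W', W', (sub_add_cancel _ _).symm, fun s ↦ ?_, fun s ↦ ?_,
    fun s ↦ ⟨hcW' s ▸ hc₁ s, hcW' s ▸ hc₂ s⟩, fun s h ↦ ?_⟩
  · -- `W₀|` is rational of type `(l+1, l+1)`
    rw [map_sub]
    refine ⟨?_, (hW s).2.sub (hf.isSmoothProjective s) (hLW'_typ s)⟩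
    have hneg : IsRationalClass
        (-(complexBetti.map (fiberι f s) (2 * (l + 1)) (lefschetzPowTo K 1 (2 * l) (2 * (l + 1)) hm₁ W'))) := by
      simpa using (hLW'_rat s).smul (-1)
    simpa [sub_eq_add_neg] using (hW s).1.add hneg
  · -- `W₀|` is primitive: `P^{2(l+1)} = ker L^{i+1}` (`2(l+1) + (i+1) = n + 1`) and `L^{i+1} (W| - (L_K W')|) = D| - D|`
    rw [primitiveClasses_eq_ker _ n hln (show 2 * (l + 1) + (i + 1) = n + 1 by omega) hm, LinearMap.mem_ker, map_sub,
      map_sub, hLLW', ← hDs, sub_self]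
  · -- where `W|` is algebraic: `D| = L^{i+1} W|` is, hence `W'|` by `A(𝒳_s, K|)` (Lieberman), hence `W₀| = W| - K| ∪ W'|`
    have hD_alg : complexBetti.map (fiberι f s) (2 * (l + 1 + (i + 1))) D ∈
        algebraicClasses (fiberOver f s) (l + 1 + (i + 1)) := by
      rw [hDs, ← hΛ s]
      exact (Λ s).L_mem_algebraicClasses_of_mem (i + 1) (l + 1) hm h
    have hW'_alg : complexBetti.map (fiberι f s) (2 * l) W' ∈ algebraicClasses (fiberOver f s) l := by
      obtain ⟨A', hA'dim, ⟨e⟩⟩ := hA s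
      rw [← hcW' s]
      exact mem_algebraicClasses_of_lefschetzPowTo_mem
        (standardConjectureA_of_iso_abelianVariety (hf.isSmoothProjective s) hA'dim e (hK s)) hjk hm₂
        (show l + (1 + (i + 1)) = l + 1 + (i + 1) by omega) (c s) (by rw [hc₃' s]; exact hD_alg)
    refine ⟨?_, hW'_alg⟩
    rw [map_sub]
    refine Submodule.sub_mem _ h ?_
    rw [hLW', ← hΛ s]
    exact (Λ s).L_mem_algebraicClasses_of_mem 1 l hm₁ hW'_alg

/-! ## §2 Per carrier: the fibrewise-primitive instances of row b02 in codimension `2 ≤ p ≤ n/2` decide (fact-free) -/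

/-- **On an abelian-fibred quasi-projective carrier, the conclusion of row b02 in EVERY codimension follows from its instances
on fibrewise `K`-PRIMITIVE classes of codimension `2 ≤ p ≤ n/2`** — for any prescribed set `T` of fibres and anchor `s₀`; the
variational form of AbelianAll part XIV `mem_algebraicClasses_of_forall_mem_primitiveClasses`. Inside the lower half, strong
induction on `p`: `p = 0` (`algebraicClasses_zero`), `p = 1` (Lefschetz `(1,1)` on the fibre, `lefschetzOneOne_rational_holds`),
`p = l + 2`: `W = W₀ + L_K W'` globally (§1), `W₀|` algebraic on `T` by the primitive instance, `W'|` by induction, `K| ∪ W'|` by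
`HardLefschetzNFold.L_mem_algebraicClasses_of_mem`; above the middle the shadow part's `map_fiberι_mem_algebraicClasses_of_lowerHalf`.
FACT-FREE. [cite: VoisinHodgeI2002, Thm. 6.25, Cor. 6.26, Rem. 6.27, §7.1.2 and Thm. 11.30] [cite: VoisinHodgeII2003, Thm. 4.18
and §9.2.4 Prop. 9.20] [cite: KerrPearlstein2011, §3.1] [cite: Lieberman1968, main theorem] -/
theorem map_fiberι_mem_algebraicClasses_of_forall_mem_primitiveClasses (f : 𝒳 ⟶ S) {n : ℕ}
    (hf : IsSmoothProjectiveFamily f n) (h𝒳 : IsQuasiProjectiveOver 𝒳) (hS : IsQuasiProjectiveOver S)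
    [IrreducibleSpace S.left] (hSs : AlgebraicGeometry.Smooth S.hom)
    (hA : ∀ s : ComplexPoints S, ∃ A' : AbelianVariety ℂ, A'.dim = n ∧ Nonempty (A'.X ≅ fiberOver f s))
    (K : complexBetti 𝒳 2)
    (hK : ∀ s : ComplexPoints S, IsPolarizationClass n (fiberOver f s) (complexBetti.map (fiberι f s) 2 K))
    (T : Set (ComplexPoints S)) {s₀ : ComplexPoints S}
    (hprim : ∀ p : ℕ, 2 ≤ p → 2 * p ≤ n → ∀ W : complexBetti 𝒳 (2 * p),
      (∀ s : ComplexPoints S, IsRationalClass (complexBetti.map (fiberι f s) (2 * p) W) ∧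
        IsOfHodgeType n (fiberOver f s) (2 * p) p p (complexBetti.map (fiberι f s) (2 * p) W)) →
      (∀ s : ComplexPoints S, complexBetti.map (fiberι f s) (2 * p) W ∈
        primitiveClasses (complexBetti.map (fiberι f s) 2 K) n (2 * p)) →
      complexBetti.map (fiberι f s₀) (2 * p) W ∈ algebraicClasses (fiberOver f s₀) p →
      ∀ s ∈ T, complexBetti.map (fiberι f s) (2 * p) W ∈ algebraicClasses (fiberOver f s) p)
    (p : ℕ) (W : complexBetti 𝒳 (2 * p))
    (hW : ∀ s : ComplexPoints S, IsRationalClass (complexBetti.map (fiberι f s) (2 * p) W) ∧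
      IsOfHodgeType n (fiberOver f s) (2 * p) p p (complexBetti.map (fiberι f s) (2 * p) W))
    (h₀ : complexBetti.map (fiberι f s₀) (2 * p) W ∈ algebraicClasses (fiberOver f s₀) p) :
    ∀ s ∈ T, complexBetti.map (fiberι f s) (2 * p) W ∈ algebraicClasses (fiberOver f s) p := by
  choose Λ hΛ using fun s ↦ (hK s).exists_hardLefschetzNFold (hf.isSmoothProjective s)
  -- the lower half, by strong induction on the codimension
  have hlow : ∀ q : ℕ, 2 * q ≤ n → ∀ W' : complexBetti 𝒳 (2 * q),
      (∀ s : ComplexPoints S, IsRationalClass (complexBetti.map (fiberι f s) (2 * q) W') ∧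
        IsOfHodgeType n (fiberOver f s) (2 * q) q q (complexBetti.map (fiberι f s) (2 * q) W')) →
      complexBetti.map (fiberι f s₀) (2 * q) W' ∈ algebraicClasses (fiberOver f s₀) q →
      ∀ s ∈ T, complexBetti.map (fiberι f s) (2 * q) W' ∈ algebraicClasses (fiberOver f s) q := by
    intro q
    induction q using Nat.strong_induction_on with
    | _ q ih =>
    intro hqn W' hW' h₀' s hs
    rcases q with _ | _ | l
    · -- `q = 0`
      rw [algebraicClasses_zero]
      exact Submodule.mem_top
    · -- `q = 1`: Lefschetz `(1,1)` on the fibre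
      exact lefschetzOneOne_rational_holds (hf.isSmoothProjective s) _ (hW' s).1 (hW' s).2
    · -- `q = l + 2`: the first Lefschetz step, globally (§1)
      obtain ⟨W₀, W₁, hdec, hW₀, hP₀, hW₁, halg⟩ :=
        exists_primitive_add_lefschetzPowTo f hf h𝒳 hS hSs hA K hK hqn W' hW'
      obtain ⟨h₀₀, h₀₁⟩ := halg s₀ h₀'
      have h₁ : complexBetti.map (fiberι f s) (2 * (l + 1)) W₁ ∈ algebraicClasses (fiberOver f s) (l + 1) :=
        ih (l + 1) (by omega) (by omega) W₁ hW₁ h₀₁ s hs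
      have h₂ : complexBetti.map (fiberι f s) (2 * (l + 1 + 1)) W₀ ∈ algebraicClasses (fiberOver f s) (l + 1 + 1) :=
        hprim (l + 1 + 1) (by omega) hqn W₀ hW₀ hP₀ h₀₀ s hs
      rw [hdec, map_add, map_lefschetzPowTo]
      refine Submodule.add_mem _ h₂ ?_
      rw [← hΛ s]
      exact (Λ s).L_mem_algebraicClasses_of_mem 1 (l + 1) _ h₁
  exact map_fiberι_mem_algebraicClasses_of_lowerHalf f hf h𝒳 hS hSs hA T hlow p W hW h₀

/-! ## Audit: fact-free (closures are the three standard axioms; no named fact, no `HC_CM`) -/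

#print axioms Summit.HodgeConjecture.HodgeConjecture.Ring2.Binders.exists_primitive_add_lefschetzPowTo
#print axioms Summit.HodgeConjecture.HodgeConjecture.Ring2.Binders.map_fiberι_mem_algebraicClasses_of_forall_mem_primitiveClasses

end Summit.HodgeConjecture.HodgeConjecture.Ring2.Binders

end
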